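import Literature.NumberTheory.EllipticCurves.FormalGroupDictionaryProofs
import Mathlib.AlgebraicGeometry.EllipticCurve.Affine.Point
import Mathlib.Algebra.CharP.Two
import HarnessLib

/-!
# J1 `TranslationJet` of the seed line `jet-character-sums` (crux `SignedMuSeedAtTwoPlus`, stmt-BirchSwinnertonDyer-21438 =
# `stub_residualSeedAtTwo` of Kμ⁺ stmt-BirchSwinnertonDyer-20689; route `ResidualThetaTransportAtTwo`):
# on `E : y² + y = x³` in characteristic `2`, `x(Q′ ⊕ T(t)) = x′ + t + x′²t² + (y′²+1)t⁴ + x′⁴t⁶ + O(t⁸)`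

Cell `bsd-wall`, width seat `bsd-wall-rtt-p4-w2` (g12). THEOREMS ONLY (no `def`, no named fact, no `sorry`); helper `--supports`
the seed crux; nothing about any habitat curve, Selmer group or `μ`-invariant is asserted; BSD is not proved by this. The line
card `Cruxes/SignedMuSeedAtTwoPlus/Lines/jet-character-sums.md` (crux-ideate k1 g19) names as its stub J1 («support, size S–M,
plausibly provable now»; «the geometric input (i) would be typed next … not typed this session»): for `Q′ = (x′, y′) ∈ Ẽ(k)`,
`char k = 2`, and the generic point `T(t) = (t/w, 1/w)` of the formal group, `w = Σ_{j ≥ 0} t^{3·2^j}` (`w² + w = t³`),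
`x(Q′ ⊕ T(t)) = x′ + t + x′²t² + (y′² + 1)t⁴ + x′⁴t⁶ + O(t⁸)`. This file proves it, in three layers:

* §1 (any field `K` of characteristic `2`, Mathlib's chord law `WeierstrassCurve.Affine.addX ∘ slope` for ANY model with
  `a₁ = a₂ = 0`): for `x′ y′ z w ∈ K`, `w ≠ 0`, `w² + w = z³`, `z + x′w ≠ 0`:
  **`E.addX x′ (z/w) (E.slope x′ (z/w) y′ (1/w)) = x′ + w (1 + x′² z + y′² w) / (z + x′ w)²`** (`addX_translate`) — the EXACT
  `x`-coordinate of `Q′ ⊕ T` (`T = (z/w, 1/w)` lies on `y² + y = x³`, `equation_T`); cleared of denominators it is the identity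
  `w (1 + y′w)² + z (z + x′w)² = w² (1 + x′² z + y′² w)` (`chord_identity`). The curve equation for `Q′` is NOT used: the pole
  of `λ²` against that of `x(T) = z/w` cancels by `w − z³ = w²` alone.
* §2 (power series over any commutative ring `R` of characteristic `2`; `w ∈ R⟦X⟧` with the fixed-point equation `w = X³ + w²` of
  AEC IV.1.1 for `a₃ = 1` and `X³ ∣ w`): `X¹² ∣ w − (X³ + X⁶)` (`X_pow_dvd_sub_of_fixedPoint`); the JET CONGRUENCE
  `X¹⁰ ∣ w (1 + aX + bw) − (X + aX² + (1+b)X⁴ + a²X⁶)(X² + a w²)` for ALL `a b ∈ R` (`X_pow_ten_dvd_jet`); and the quotient: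
  **`∃ q ∈ R⟦X⟧, q · (X + x′w)² = w (1 + x′²X + y′²w)` with `X⁸ ∣ q − (X + x′²X² + (1+y′²)X⁴ + x′⁴X⁶)`** (`exists_quotient_jet`) —
  the power series `x(Q′ ⊕ T) − x′` and its `8`-jet.
* §3 (the tree's formal group): for `Ẽ = ⟨0, 0, 1, 0, 0⟩` over any `R`, `WeierstrassCurve.formalW` satisfies `w = X³ + w²`
  (`formalW_eq_X_pow_three_add_sq`, from `formalWStep_formalW`) and `X³ ∣ w`; hence in characteristic `2` the card's statement
  **`translationJet`** with `w = Ẽ.formalW` (so `T(t) = (t/w(t), 1/w(t))` IS the formal-group parametrisation `(x(z), y(z))` of AEC IV.1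
  read in characteristic `2`: `x = z/w`, `y = −1/w = 1/w`).

Consumers (J3 `LevelZeroDichotomy`, J4 of the card) read the jet coefficients `c_n(Q′)` of `Φ_{Q′}(s) = Σ_P 1/(x(Q′ ⊕ T(s)) − x_P)` off
`exists_quotient_jet` / `translationJet`: no odd power of `t` between `t` and `t⁷` survives, `[t²] = x′²`, `[t⁴] = y′² + 1`, `[t⁶] = x′⁴`.
The card's numerics (kit j318048: `[t⁰] = x′`, `[t¹] = 1` on 51 rows) are instances.

References: [SilvermanAEC2009] J. H. Silverman, *The Arithmetic of Elliptic Curves*, III.2.3 (group law), IV.1.1 (`w(z)`), IV.1 (the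
expansions `x = z/w`, `y = −1/w`); the card `Cruxes/SignedMuSeedAtTwoPlus/Ideas/jet-character-sums.md` (Lever (i)).
-/

set_option autoImplicit false
set_option linter.dupNamespace false

noncomputable section

open PowerSeries

namespace Summit.BirchSwinnertonDyer.BirchSwinnertonDyer.Theorems.SignedMuAtTwo.JetCharacterSums

/-! ## §1 The exact `x`-coordinate of `Q′ ⊕ T` in a field of characteristic `2` -/

section FieldIdentity

variable {K : Type*} [Field K] [CharP K 2]

/-- **The chord identity behind J1** (characteristic `2`, `w² + w = z³`):
`w (1 + y′w)² + z (z + x′w)² = w² (1 + x′² z + y′² w)`. No curve equation for `(x′, y′)` is used. [cite: SilvermanAEC2009, III.2.3] -/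
theorem chord_identity (x y z w : K) (hw : w ^ 2 + w = z ^ 3) :
    w * (1 + y * w) ^ 2 + z * (z + x * w) ^ 2 = w ^ 2 * (1 + x ^ 2 * z + y ^ 2 * w) := by
  have h2 : (2 : K) = 0 := CharTwo.two_eq_zero
  linear_combination (-1 : K) * hw + (w + y * w ^ 2 + x * z ^ 2 * w) * h2

omit [CharP K 2] in
/-- `T = (z/w, 1/w)` lies on `y² + y = x³` (any model with `a₁ = a₂ = a₄ = a₆ = 0`, `a₃ = 1`) as soon as `w² + w = z³`,
`w ≠ 0`. [cite: SilvermanAEC2009, IV.1.1] -/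
theorem equation_T (E : WeierstrassCurve.Affine K) (h₁ : E.a₁ = 0) (h₂ : E.a₂ = 0) (h₃ : E.a₃ = 1) (h₄ : E.a₄ = 0)
    (h₆ : E.a₆ = 0) {z w : K} (hw : w ^ 2 + w = z ^ 3) (hw0 : w ≠ 0) : E.Equation (z / w) (1 / w) := by
  rw [WeierstrassCurve.Affine.equation_iff, h₁, h₂, h₃, h₄, h₆]
  field_simp
  linear_combination hw

/-- In characteristic `2`: `z + x′w ≠ 0` forces `x′ ≠ z/w` (for `w ≠ 0`). [folklore] -/
theorem ne_div_of_add_mul_ne_zero {x z w : K} (hw0 : w ≠ 0) (hD : z + x * w ≠ 0) : x ≠ z / w := by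
  intro h
  apply hD
  rw [h, div_mul_cancel₀ _ hw0]
  exact CharTwo.add_self_eq_zero z

omit [CharP K 2] in
/-- The chord slope through `Q′ = (x′, y′)` and `T = (z/w, 1/w)` (any characteristic): `(y′ + 1/w)/(x′ + z/w) = (1 + y′w)/(z + x′w)`.
[cite: SilvermanAEC2009, III.2.3] -/
theorem slope_translate_eq (x y z w : K) (hw0 : w ≠ 0) (hD : z + x * w ≠ 0) :
    (y + 1 / w) / (x + z / w) = (1 + y * w) / (z + x * w) := by
  have hxz : x + z / w ≠ 0 := by
    intro h
    apply hD
    have : (x + z / w) * w = 0 := by rw [h, zero_mul]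
    rw [add_mul, div_mul_cancel₀ _ hw0] at this
    linear_combination this
  rw [div_eq_div_iff hxz hD]
  field_simp
  ring

variable [DecidableEq K]

/-- **J1, exact form: the `x`-coordinate of `Q′ ⊕ T`.** For any Weierstrass model over a field of characteristic `2` with
`a₁ = a₂ = 0`, `Q′ = (x′, y′)` arbitrary and `T = (z/w, 1/w)` with `w ≠ 0`, `w² + w = z³`, `z + x′w ≠ 0`:
`addX x′ (z/w) (slope x′ (z/w) y′ (1/w)) = x′ + w (1 + x′² z + y′² w)/(z + x′w)²` — Mathlib's chord law
(`slope_of_X_ne`, `addX`), the pole of `λ²` cancelling against `x(T) = z/w` through `w − z³ = w²`. [cite: SilvermanAEC2009, III.2.3] -/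
theorem addX_translate (E : WeierstrassCurve.Affine K) (h₁ : E.a₁ = 0) (h₂ : E.a₂ = 0) (x y z w : K)
    (hw : w ^ 2 + w = z ^ 3) (hw0 : w ≠ 0) (hD : z + x * w ≠ 0) :
    E.addX x (z / w) (E.slope x (z / w) y (1 / w)) = x + w * (1 + x ^ 2 * z + y ^ 2 * w) / (z + x * w) ^ 2 := by
  have hx : x ≠ z / w := ne_div_of_add_mul_ne_zero hw0 hD
  have hD2 : (z + x * w) ^ 2 ≠ 0 := pow_ne_zero 2 hD
  rw [WeierstrassCurve.Affine.slope_of_X_ne hx, WeierstrassCurve.Affine.addX, h₁, h₂]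
  simp only [CharTwo.sub_eq_add, zero_mul, add_zero]
  rw [slope_translate_eq x y z w hw0 hD, div_pow]
  -- `(1 + yw)²/(z + xw)² + z/w = w N/(z + xw)²` by the chord identity
  have key : (1 + y * w) ^ 2 / (z + x * w) ^ 2 + z / w = w * (1 + x ^ 2 * z + y ^ 2 * w) / (z + x * w) ^ 2 := by
    rw [div_add_div _ _ hD2 hw0, div_eq_div_iff (mul_ne_zero hD2 hw0) hD2]
    linear_combination (z + x * w) ^ 2 * chord_identity x y z w hw
  rw [← key]
  ring

end FieldIdentity

/-! ## §2 The jet in `R⟦X⟧`, characteristic `2` -/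

section Jet

variable {R : Type*} [CommRing R] [CharP R 2]

/-- `2 = 0` in `R⟦X⟧` when `char R = 2`. [folklore] -/
theorem two_eq_zero_powerSeries : (2 : R⟦X⟧) = 0 := by
  rw [← map_ofNat (C (R := R)) 2, CharTwo.two_eq_zero, map_zero]

omit [CharP R 2] in
/-- From the fixed-point equation `w = X³ + w²` (AEC IV.1.1 for `a₃ = 1`, any characteristic):
`w − (X³ + X⁶) = w⁴ + 2X³w²`. [cite: SilvermanAEC2009, IV.1.1] -/
theorem sub_eq_of_fixedPoint {w : R⟦X⟧} (hfix : w = X ^ 3 + w ^ 2) :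
    w - (X ^ 3 + X ^ 6) = w ^ 4 + 2 * X ^ 3 * w ^ 2 := by
  have h : w - X ^ 3 - w ^ 2 = 0 := by linear_combination hfix
  linear_combination (w ^ 2 + w + X ^ 3 + 1) * h

/-- **`w ≡ X³ + X⁶ (mod X¹²)`** in characteristic `2`, for `w = X³ + w²` with `X³ ∣ w` (so `w = X³ + X⁶ + X¹² + X²⁴ + ⋯`).
[cite: SilvermanAEC2009, IV.1.1] -/
theorem X_pow_dvd_sub_of_fixedPoint {w : R⟦X⟧} (hfix : w = X ^ 3 + w ^ 2) (hX3 : X ^ 3 ∣ w) :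
    X ^ 12 ∣ w - (X ^ 3 + X ^ 6) := by
  obtain ⟨B, hB⟩ := hX3
  refine ⟨B ^ 4, ?_⟩
  rw [sub_eq_of_fixedPoint hfix]
  linear_combination (X ^ 3 * w ^ 2) * two_eq_zero_powerSeries (R := R) +
    (w ^ 3 + w ^ 2 * (X ^ 3 * B) + w * (X ^ 3 * B) ^ 2 + (X ^ 3 * B) ^ 3) * hB

/-- **The jet congruence (J1, Lever (i) of the card).** In characteristic `2`, for `w = X³ + w²`, `X³ ∣ w` and ANY `a b ∈ R`:
`X¹⁰ ∣ w (1 + aX + bw) − (X + aX² + (1 + b)X⁴ + a²X⁶) · (X² + a w²)`. (With `a = x′²`, `b = y′²` the second factor is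
`(X + x′w)²` and the bracket is the `8`-jet of `x(Q′ ⊕ T) − x′`.) [cite: SilvermanAEC2009, IV.1.1] -/
theorem X_pow_ten_dvd_jet {w : R⟦X⟧} (hfix : w = X ^ 3 + w ^ 2) (hX3 : X ^ 3 ∣ w) (a b : R) :
    X ^ 10 ∣ w * (1 + C a * X + C b * w) -
      (X + C a * X ^ 2 + C (1 + b) * X ^ 4 + C (a ^ 2) * X ^ 6) * (X ^ 2 + C a * w ^ 2) := by
  obtain ⟨r, hr⟩ := X_pow_dvd_sub_of_fixedPoint hfix hX3
  -- write `w = v + X¹² r` with `v = X³ + X⁶`; the polynomial `P(v)` is `2·D + X¹⁰·Q` identically, and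
  -- `P(w) − P(v) = (w − v)·S`
  have hw : w = (X ^ 3 + X ^ 6) + X ^ 12 * r := by rw [← hr]; ring
  rw [map_add, map_one, map_pow]
  refine ⟨(-3 * C a - C a * C b - 2 * X * C a ^ 2 + X ^ 2 * C b - X ^ 2 * C a ^ 3 - 3 * X ^ 3 * C a
      - 2 * X ^ 3 * C a * C b - X ^ 4 * C a ^ 2 - 2 * X ^ 5 * C a ^ 3 - X ^ 6 * C a - X ^ 6 * C a * C b
      - X ^ 8 * C a ^ 3)
    + X ^ 2 * r * ((1 + C a * X + C b * (w + (X ^ 3 + X ^ 6))) -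
        (X + C a * X ^ 2 + (1 + C b) * X ^ 4 + C a ^ 2 * X ^ 6) * (C a * (w + (X ^ 3 + X ^ 6)))), ?_⟩
  linear_combination (-(C a) ^ 2 * X ^ 8 + C b * X ^ 9) * two_eq_zero_powerSeries (R := R) +
    ((1 + C a * X + C b * (w + (X ^ 3 + X ^ 6))) -
      (X + C a * X ^ 2 + (1 + C b) * X ^ 4 + C a ^ 2 * X ^ 6) * (C a * (w + (X ^ 3 + X ^ 6)))) * hw

omit [CharP R 2] in
/-- Cancelling a power of `X`: `X^{n+k} ∣ X^k · F ⇒ X^n ∣ F` (coefficients shift). [folklore] -/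
theorem X_pow_dvd_of_X_pow_mul_dvd {F : R⟦X⟧} {n k : ℕ} (h : X ^ (n + k) ∣ X ^ k * F) : X ^ n ∣ F := by
  rw [X_pow_dvd_iff] at h ⊢
  intro m hm
  have := h (m + k) (by omega)
  rwa [coeff_X_pow_mul] at this

/-- In characteristic `2`: `(X + x′w)² = X² + x′² w²`. [folklore] -/
theorem sq_X_add_C_mul (x : R) (w : R⟦X⟧) : (X + C x * w) ^ 2 = X ^ 2 + C (x ^ 2) * w ^ 2 := by
  rw [map_pow]
  linear_combination (X * C x * w) * two_eq_zero_powerSeries (R := R)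

/-- **J1 as a power series: the quotient and its `8`-jet.** In characteristic `2`, for `w = X³ + w²` with `X³ ∣ w` and any
`x′ y′ ∈ R`, the power series `q = x(Q′ ⊕ T) − x′` exists — `q · (X + x′w)² = w (1 + x′²X + y′²w)` — and
**`q ≡ X + x′²X² + (1 + y′²)X⁴ + x′⁴X⁶ (mod X⁸)`**: no odd power of `X` between `X` and `X⁷`, `[X²] = x′²`, `[X⁴] = y′² + 1`,
`[X⁶] = x′⁴`. (`q = X·B·(1 + x′²X + y′²w)·u⁻²` with `w = X³B`, `u = 1 + x′X²B`.) [cite: SilvermanAEC2009, IV.1.1] -/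
theorem exists_quotient_jet {w : R⟦X⟧} (hfix : w = X ^ 3 + w ^ 2) (hX3 : X ^ 3 ∣ w) (x y : R) :
    ∃ q : R⟦X⟧, q * (X + C x * w) ^ 2 = w * (1 + C (x ^ 2) * X + C (y ^ 2) * w) ∧
      X ^ 8 ∣ q - (X + C (x ^ 2) * X ^ 2 + C (1 + y ^ 2) * X ^ 4 + C (x ^ 4) * X ^ 6) := by
  obtain ⟨B, hB⟩ := hX3
  have hcu : constantCoeff ((1 + C x * X ^ 2 * B) ^ 2) = ((1 : Rˣ) : R) := by simp
  have hinv : (1 + C x * X ^ 2 * B) ^ 2 * PowerSeries.invOfUnit ((1 + C x * X ^ 2 * B) ^ 2) 1 = 1 :=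
    PowerSeries.mul_invOfUnit _ _ hcu
  have hD : X + C x * w = X * (1 + C x * X ^ 2 * B) := by rw [hB]; ring
  -- the quotient
  have hqD : X * B * (1 + C (x ^ 2) * X + C (y ^ 2) * w) * PowerSeries.invOfUnit ((1 + C x * X ^ 2 * B) ^ 2) 1 *
      (X + C x * w) ^ 2 = w * (1 + C (x ^ 2) * X + C (y ^ 2) * w) := by
    calc _ = X ^ 3 * B * (1 + C (x ^ 2) * X + C (y ^ 2) * w) *
          ((1 + C x * X ^ 2 * B) ^ 2 * PowerSeries.invOfUnit ((1 + C x * X ^ 2 * B) ^ 2) 1) := by rw [hD]; ring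
      _ = w * (1 + C (x ^ 2) * X + C (y ^ 2) * w) := by rw [hinv, hB]; ring
  refine ⟨X * B * (1 + C (x ^ 2) * X + C (y ^ 2) * w) * PowerSeries.invOfUnit ((1 + C x * X ^ 2 * B) ^ 2) 1, hqD, ?_⟩
  set q := X * B * (1 + C (x ^ 2) * X + C (y ^ 2) * w) * PowerSeries.invOfUnit ((1 + C x * X ^ 2 * B) ^ 2) 1 with hq
  set J : R⟦X⟧ := X + C (x ^ 2) * X ^ 2 + C (1 + y ^ 2) * X ^ 4 + C (x ^ 4) * X ^ 6 with hJ
  -- the jet congruence with `a = x′²`, `b = y′²`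
  have hjet := X_pow_ten_dvd_jet hfix ⟨B, hB⟩ (x ^ 2) (y ^ 2)
  rw [show (x ^ 2) ^ 2 = x ^ 4 by ring, ← hJ, ← sq_X_add_C_mul, ← hqD, ← sub_mul] at hjet
  -- cancel `X²` and the unit `u²`
  have h2 : (q - J) * (X + C x * w) ^ 2 = X ^ 2 * ((q - J) * (1 + C x * X ^ 2 * B) ^ 2) := by rw [hD]; ring
  rw [h2] at hjet
  have h3 : X ^ 8 ∣ (q - J) * (1 + C x * X ^ 2 * B) ^ 2 := X_pow_dvd_of_X_pow_mul_dvd (n := 8) (k := 2) hjet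
  have h4 := h3.mul_right (PowerSeries.invOfUnit ((1 + C x * X ^ 2 * B) ^ 2) 1)
  rwa [mul_assoc, hinv, mul_one] at h4

end Jet

/-! ## §3 The tree's formal group of `Ẽ = ⟨0, 0, 1, 0, 0⟩`: the card's statement with `w = WeierstrassCurve.formalW` -/

section FormalGroup

variable (R : Type*) [CommRing R]

/-- **AEC IV.1.1 for `y² + y = x³`: `w = X³ + w²`** (any characteristic; `formalWStep w = X³ + a₃ w²` with `a₃ = 1`, and
`formalWStep_formalW`). [cite: SilvermanAEC2009, IV.1.1] -/
theorem formalW_eq_X_pow_three_add_sq :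
    (⟨0, 0, 1, 0, 0⟩ : WeierstrassCurve R).formalW = X ^ 3 + (⟨0, 0, 1, 0, 0⟩ : WeierstrassCurve R).formalW ^ 2 := by
  have h := (⟨0, 0, 1, 0, 0⟩ : WeierstrassCurve R).formalWStep_formalW
  simp only [WeierstrassCurve.formalWStep, map_zero, map_one, zero_mul, add_zero, one_mul] at h
  exact h.symm

/-- `X³ ∣ w` for the tree's `formalW` (`w = X³ · formalWDivCube`). [cite: SilvermanAEC2009, IV.1.1] -/
theorem X_pow_three_dvd_formalW : X ^ 3 ∣ (⟨0, 0, 1, 0, 0⟩ : WeierstrassCurve R).formalW :=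
  ⟨_, (⟨0, 0, 1, 0, 0⟩ : WeierstrassCurve R).formalW_eq_X_pow_mul_formalWDivCube⟩

variable [CharP R 2]

/-- In characteristic `2`: `w ≡ X³ + X⁶ (mod X¹²)` for the formal `w` of `y² + y = x³` (`w = Σ_{j ≥ 0} X^{3·2^j}`).
[cite: SilvermanAEC2009, IV.1.1] -/
theorem X_pow_dvd_formalW_sub : X ^ 12 ∣ (⟨0, 0, 1, 0, 0⟩ : WeierstrassCurve R).formalW - (X ^ 3 + X ^ 6) :=
  X_pow_dvd_sub_of_fixedPoint (formalW_eq_X_pow_three_add_sq R) (X_pow_three_dvd_formalW R)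

/-- **J1 `TranslationJet` (line `jet-character-sums` of the seed crux 21438), kernel form.** Over any commutative ring `R` of
characteristic `2`, with `w = formalW` of `Ẽ = y² + y = x³` (so `T(t) = (t/w, 1/w)` is the formal-group point of AEC IV.1) and any
`x′ y′ ∈ R`: the power series `q = x(Q′ ⊕ T) − x′`, characterised by `q · (X + x′w)² = w (1 + x′²X + y′²w)` (the chord law,
`addX_translate`), satisfies `q ≡ X + x′²X² + (y′² + 1)X⁴ + x′⁴X⁶ (mod X⁸)`, i.e.
`x(Q′ ⊕ T(t)) = x′ + t + x′²t² + (y′²+1)t⁴ + x′⁴t⁶ + O(t⁸)`. [cite: SilvermanAEC2009, IV.1.1] -/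
theorem translationJet (x y : R) :
    ∃ q : R⟦X⟧, q * (X + C x * (⟨0, 0, 1, 0, 0⟩ : WeierstrassCurve R).formalW) ^ 2 =
        (⟨0, 0, 1, 0, 0⟩ : WeierstrassCurve R).formalW *
          (1 + C (x ^ 2) * X + C (y ^ 2) * (⟨0, 0, 1, 0, 0⟩ : WeierstrassCurve R).formalW) ∧
      X ^ 8 ∣ q - (X + C (x ^ 2) * X ^ 2 + C (1 + y ^ 2) * X ^ 4 + C (x ^ 4) * X ^ 6) :=
  exists_quotient_jet (formalW_eq_X_pow_three_add_sq R) (X_pow_three_dvd_formalW R) x y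

end FormalGroup

end Summit.BirchSwinnertonDyer.BirchSwinnertonDyer.Theorems.SignedMuAtTwo.JetCharacterSums
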